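import Literature.Barriers.FinalStateConjecture.KleinGordonRealMode
import Literature.Barriers.FinalStateConjecture.KleinGordonJostFamily
import HarnessLib

/-!
# The horizon-regular radial solution as a smooth family in the parameters `(ω, Λ, μ)`

Topic `Literature/Barriers/FinalStateConjecture` (namespace `Literature.Barriers.FinalStateConjecture`),
continuing `KleinGordonHorizonModes.lean` (the explicit local solution `hzRloc = P·ρ` of the
radial ODE (2.2) with the boundary condition (2.3), on the horizon disc, jointly smooth in the
Heun parameters), `KleinGordonRealMode.lean` (its global continuation at the threshold and the
real mode) and `KleinGordonJostFamily.lean` (normal form). For the perturbation argument of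
Shlapentokh-Rothman, CMP 329 (2014), §4.3 (Prop. 4.2, Lemma 4.5) one needs the horizon-regular
solution as a family in `p = (ω, Λ, μ) ∈ ℂ × ℂ × ℝ` on the open parameter set
`hzU = {‖K₊(ω)‖ < c/8}` (which contains the real threshold points `(ω₀, λ, μ)`), SMOOTH in `p` at
every fixed radius. Everything is proved:

* `hPair h m p = (R_p, R_p')` — the global solution pair on `(r₊, ∞)` with the Cauchy datum of
  `hzRloc(p)` at `r₁ = r₊ + c/5` (`hPair_spec`); on `hzU` it agrees with `hzRloc(p)`, `hzRloc'(p)`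
  on the horizon disc (`hPair_eqOn`), and with the threshold pair `radPair` of
  `KleinGordonRealMode.lean` at `p = (ω₀, λ, μ)` (`hPair_base`);
* smoothness in `p ∈ hzU` of the data (`contDiffAt_hzRloc_par`, `contDiffAt_hzRloc'_par`: the
  Heun series is jointly smooth in its variable and parameters, `HeunLocalSeries.lean`) and of the
  values `p ↦ (R_p(t), R_p'(t))` at every `t > r₊` (`contDiffOn_hPair_apply`; beyond the disc by
  smooth dependence of the transport on parameters, `LinearTransport.exists_transport_joint`);
* the normal form `yh p = √Δ R_p`, `yh' p` solving `y'' = kgQc(·; ω, Λ, μ²) y` on `(r₊, ∞)`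
  (`isSol2_yh`), smooth in `p` at fixed `t` (`contDiffOn_yh_apply`);
* the bridge from `IsRadialSolution` (`exists_horizonRadial`): a radial solution agreeing with
  `hzRloc(p)` on the disc IS `R_p`, with `deriv R = R_p'` (`eqOn_hPair_of_isRadialSolution`).

## References

* Y. Shlapentokh-Rothman, Comm. Math. Phys. 329 (2014) 859–891, §2 (2.2)–(2.3), §4.3, App. A.
  Key `ShlapentokhRothman2014KleinGordon`.
-/

noncomputable section

open Set Filter Topology Complex
open scoped ContDiff

namespace Literature.Barriers.FinalStateConjecture

open Literature.Geometry.Lorentzian Literature.Geometry.Lorentzian.Kerr Literature.Analysis.ODE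

variable {M a : ℝ} {m : ℤ}

/-- The parameter space `(ω, Λ, μ) ∈ ℂ × ℂ × ℝ` (a real Banach space). [folklore] -/
abbrev HPar : Type := ℂ × ℂ × ℝ

/-- **The admissible parameter set** `hzU = {p | ‖K₊(ω)‖ < c/8}` (the horizon series converges on
the disc of radius `2c/5`). [folklore] -/
def hzU (M a : ℝ) (m : ℤ) : Set HPar := {p | ‖hzKplus M a m p.1‖ < hzC M a / 8}

/-- `hzU` is open. [folklore] -/
theorem isOpen_hzU : IsOpen (hzU M a m) := by
  have hc : Continuous fun p : HPar ↦ ‖hzKplus M a m p.1‖ := by unfold hzKplus; fun_prop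
  exact isOpen_lt hc continuous_const

/-- The real threshold points lie in `hzU` (`K₊(ω₀) = 0`). [folklore] -/
theorem mem_hzU_omega0 (h : IsSubextremal M a) (lam μ : ℝ) :
    (((kgOmega0 M a m : ℂ), (lam : ℂ), μ) : HPar) ∈ hzU M a m :=
  norm_hzKplus_omega0_lt (m := m) h

/-! ### Uniqueness of solved-form solution pairs on `(r₊, ∞)` -/

/-- Two solution pairs of the solved-form radial ODE on `(r₊, ∞)` with the same data at some
`t₀ > r₊` coincide (with their derivatives). [folklore] -/
theorem eqOn_pair_Ioi (h : IsSubextremal M a) {w Λ : ℂ} {μ : ℝ} {u u' v v' : ℝ → ℂ} {t₀ : ℝ} (ht₀ : rPlus M a < t₀)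
    (hu : ∀ t ∈ Ioi (rPlus M a), HasDerivAt u (u' t) t ∧
      HasDerivAt u' (-((((2 * t - 2 * M : ℝ)) : ℂ) / (delta M a t : ℂ)) * u' t + kgRadialPotential M a w m Λ μ t / (delta M a t : ℂ) ^ 2 * u t) t)
    (hv : ∀ t ∈ Ioi (rPlus M a), HasDerivAt v (v' t) t ∧
      HasDerivAt v' (-((((2 * t - 2 * M : ℝ)) : ℂ) / (delta M a t : ℂ)) * v' t + kgRadialPotential M a w m Λ μ t / (delta M a t : ℂ) ^ 2 * v t) t)
    (h0 : u t₀ = v t₀) (h1 : u' t₀ = v' t₀) : EqOn u v (Ioi (rPlus M a)) ∧ EqOn u' v' (Ioi (rPlus M a)) := by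
  have hp := (contDiffOn_hzRadialP h (n := ∞)).continuousOn
  have hq := (contDiffOn_hzRadialQ (w := w) (m := m) (Λ := Λ) (μ := μ) h (n := ∞)).continuousOn
  suffices key : ∀ t ∈ Ioi (rPlus M a), u t = v t ∧ u' t = v' t from ⟨fun t ht ↦ (key t ht).1, fun t ht ↦ (key t ht).2⟩
  intro t ht
  set b : ℝ := max t t₀ + 1
  have hsub : Ioo (rPlus M a) b ⊆ Ioi (rPlus M a) := fun s hs ↦ hs.1
  have hb0 : t₀ ∈ Ioo (rPlus M a) b := ⟨ht₀, by simp only [b]; linarith [le_max_right t t₀]⟩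
  have hbt : t ∈ Ioo (rPlus M a) b := ⟨ht, by simp only [b]; linarith [le_max_left t t₀]⟩
  have he := eqOn_of_solution_Ioo (hp.mono hsub) (hq.mono hsub) hb0 (fun s hs ↦ hu s (hsub hs)) (fun s hs ↦ hv s (hsub hs)) h0 h1
  exact ⟨he.1 hbt, he.2 hbt⟩

/-! ### The global solution pair `hPair p` -/

/-- Existence of the global pair with the datum of `hzRloc(p)` at `r₁`. [cite: ShlapentokhRothman2014KleinGordon, §2 (2.2)] -/
theorem exists_hPair (h : IsSubextremal M a) (p : HPar) :
    ∃ RR : (ℝ → ℂ) × (ℝ → ℂ),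
      RR.1 (kgR1 M a) = hzRloc M a m p.1 p.2.1 p.2.2 (kgR1 M a) ∧
      RR.2 (kgR1 M a) = hzRloc' M a m p.1 p.2.1 p.2.2 (kgR1 M a) ∧
      ∀ t ∈ Ioi (rPlus M a), HasDerivAt RR.1 (RR.2 t) t ∧
        HasDerivAt RR.2 (-((((2 * t - 2 * M : ℝ)) : ℂ) / (delta M a t : ℂ)) * RR.2 t +
          kgRadialPotential M a p.1 m p.2.1 p.2.2 t / (delta M a t : ℂ) ^ 2 * RR.1 t) t := by
  obtain ⟨u, u', hu0, hu1, hsol⟩ := exists_solution_Ioi (contDiffOn_hzRadialP h (n := ∞)).continuousOn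
    (contDiffOn_hzRadialQ (w := p.1) (m := m) (Λ := p.2.1) (μ := p.2.2) h (n := ∞)).continuousOn
    (kgR1 M a) (hzRloc M a m p.1 p.2.1 p.2.2 (kgR1 M a)) (hzRloc' M a m p.1 p.2.1 p.2.2 (kgR1 M a))
  exact ⟨(u, u'), hu0, hu1, hsol⟩

/-- **The horizon-regular solution pair** `hPair p = (R_p, R_p')` on `(r₊, ∞)` (a choice). [cite: ShlapentokhRothman2014KleinGordon, §2 (2.2)–(2.3)] -/
def hPair (h : IsSubextremal M a) (m : ℤ) (p : HPar) : (ℝ → ℂ) × (ℝ → ℂ) := Classical.choose (exists_hPair (m := m) h p)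

/-- The defining properties of `hPair`. [folklore] -/
theorem hPair_spec (h : IsSubextremal M a) (p : HPar) :
    (hPair h m p).1 (kgR1 M a) = hzRloc M a m p.1 p.2.1 p.2.2 (kgR1 M a) ∧
      (hPair h m p).2 (kgR1 M a) = hzRloc' M a m p.1 p.2.1 p.2.2 (kgR1 M a) ∧
      ∀ t ∈ Ioi (rPlus M a), HasDerivAt (hPair h m p).1 ((hPair h m p).2 t) t ∧
        HasDerivAt (hPair h m p).2 (-((((2 * t - 2 * M : ℝ)) : ℂ) / (delta M a t : ℂ)) * (hPair h m p).2 t +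
          kgRadialPotential M a p.1 m p.2.1 p.2.2 t / (delta M a t : ℂ) ^ 2 * (hPair h m p).1 t) t :=
  Classical.choose_spec (exists_hPair (m := m) h p)

attribute [irreducible] hPair

/-- **On `hzU` the pair agrees with the explicit local solution** on the horizon disc. [folklore] -/
theorem hPair_eqOn (h : IsSubextremal M a) {p : HPar} (hp : p ∈ hzU M a m) :
    EqOn (hPair h m p).1 (hzRloc M a m p.1 p.2.1 p.2.2) (Ioo (rPlus M a) (rPlus M a + 2 * hzC M a / 5)) ∧
      EqOn (hPair h m p).2 (hzRloc' M a m p.1 p.2.1 p.2.2) (Ioo (rPlus M a) (rPlus M a + 2 * hzC M a / 5)) := by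
  obtain ⟨h0, h1, hsol⟩ := hPair_spec (m := m) h p
  have hpc := (contDiffOn_hzRadialP h (n := ∞)).continuousOn
  have hqc := (contDiffOn_hzRadialQ (w := p.1) (m := m) (Λ := p.2.1) (μ := p.2.2) h (n := ∞)).continuousOn
  have hloc : ∀ t ∈ Ioo (rPlus M a) (rPlus M a + 2 * hzC M a / 5),
      HasDerivAt (hzRloc M a m p.1 p.2.1 p.2.2) (hzRloc' M a m p.1 p.2.1 p.2.2 t) t ∧
      HasDerivAt (hzRloc' M a m p.1 p.2.1 p.2.2)
        (-((((2 * t - 2 * M : ℝ)) : ℂ) / (delta M a t : ℂ)) * hzRloc' M a m p.1 p.2.1 p.2.2 t +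
          kgRadialPotential M a p.1 m p.2.1 p.2.2 t / (delta M a t : ℂ) ^ 2 * hzRloc M a m p.1 p.2.1 p.2.2 t) t :=
    fun t ht ↦ ⟨hasDerivAt_hzRloc h hp ht.1 ht.2, hasDerivAt_hzRloc' h hp ht.1 ht.2⟩
  exact eqOn_of_solution_Ioo (hpc.mono Ioo_subset_Ioi_self) (hqc.mono Ioo_subset_Ioi_self) (kgR1_mem h)
    (fun t ht ↦ hsol t ht.1) hloc h0 h1

/-- **At the threshold points the pair is the threshold pair `radPair`.** [folklore] -/
theorem hPair_base (h : IsSubextremal M a) (lam μ : ℝ) :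
    EqOn (hPair h m (((kgOmega0 M a m : ℂ), (lam : ℂ), μ) : HPar)).1 (radPair h m lam μ).1 (Ioi (rPlus M a)) ∧
      EqOn (hPair h m (((kgOmega0 M a m : ℂ), (lam : ℂ), μ) : HPar)).2 (radPair h m lam μ).2 (Ioi (rPlus M a)) := by
  obtain ⟨h0, h1, hsol⟩ := hPair_spec (m := m) h (((kgOmega0 M a m : ℂ), (lam : ℂ), μ) : HPar)
  obtain ⟨g0, g1, gsol⟩ := radPair_spec (m := m) h lam μ
  exact eqOn_pair_Ioi (m := m) h (kgR1_mem h).1 hsol gsol (h0.trans g0.symm) (h1.trans g1.symm)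

/-! ### Smoothness of the data in the parameters -/

/-- `x ↦ (x : ℂ)` is smooth (registered for `fun_prop`). [folklore] -/
@[fun_prop] theorem contDiff_ofReal_par {n : WithTop ℕ∞} : ContDiff ℝ n (fun x : ℝ ↦ (x : ℂ)) := Complex.ofRealCLM.contDiff

/-- The Heun parameter map `p ↦ hzParam(ω, Λ, μ)` is smooth (polynomial). [folklore] -/
theorem contDiff_hzParam_par {n : WithTop ℕ∞} : ContDiff ℝ n fun p : HPar ↦ hzParam M a m p.1 p.2.1 p.2.2 := by
  refine contDiff_pi.2 fun i ↦ ?_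
  fin_cases i
  · simp only [Fin.zero_eta, hzParam_zero]; unfold hzKplus; fun_prop
  · simp only [Fin.mk_one, hzParam_one]; fun_prop
  · simp only [Fin.reduceFinMk, hzParam_two]; fun_prop
  · simp only [Fin.reduceFinMk, hzParam_three]; fun_prop
  · simp only [Fin.reduceFinMk, hzParam_four]; fun_prop
  · simp only [Fin.reduceFinMk, hzParam_five]; fun_prop

/-- The phase `p ↦ P_ω(t)` is smooth in the parameters at fixed `t` (entire in `ω`). [folklore] -/
theorem contDiff_hzPhase_par (t : ℝ) {n : WithTop ℕ∞} : ContDiff ℝ n fun p : HPar ↦ hzPhase M a m p.1 t := by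
  unfold hzPhase; fun_prop

/-- `p ↦ K_ω(t)` is smooth at fixed `t`. [folklore] -/
theorem contDiff_hzK_par (t : ℝ) {n : WithTop ℕ∞} : ContDiff ℝ n fun p : HPar ↦ hzK a m p.1 t := by
  unfold hzK; fun_prop

/-- **Smoothness of the analytic factor in the parameters**: `p ↦ ρ_p(t)` is `C^∞` at `p ∈ hzU`
for `|t − r₊| < 2c/5`. [folklore] -/
theorem contDiffAt_hzRhoC_par (h : IsSubextremal M a) {p : HPar} (hp : p ∈ hzU M a m) {t : ℝ} (ht : |t - rPlus M a| < 2 * hzC M a / 5)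
    {n : ℕ∞} : ContDiffAt ℝ n (fun q : HPar ↦ hzRhoC M a m q.1 q.2.1 q.2.2 (t : ℂ)) p := by
  have hα := norm_hzParam_zero_lt m p.1 p.2.1 p.2.2 h hp
  have hζ : ‖((t : ℂ)) - rPlus M a‖ < 2 * hzC M a / 5 := by
    rw [show ((t : ℂ)) - rPlus M a = ((t - rPlus M a : ℝ) : ℂ) by push_cast; ring, Complex.norm_real, Real.norm_eq_abs]
    exact ht
  have hξ := norm_hzXi_lt h hζ
  have hF : ContDiffAt ℝ n (fun q : ℂ × HP ↦ heunFun q.2 q.1) (hzXi M a (t : ℂ), hzParam M a m p.1 p.2.1 p.2.2) :=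
    ((contDiffAt_heunFun hξ hα (n := ∞) le_rfl).restrict_scalars ℝ).of_le (by exact_mod_cast le_top)
  have hin : ContDiff ℝ n fun q : HPar ↦ ((hzXi M a (t : ℂ), hzParam M a m q.1 q.2.1 q.2.2) : ℂ × HP) :=
    contDiff_const.prodMk contDiff_hzParam_par
  exact hF.comp p hin.contDiffAt

/-- Smoothness of `p ↦ ρ'_p(t)` at `p ∈ hzU`, `|t − r₊| < 2c/5`. [folklore] -/
theorem contDiffAt_hzRhoC'_par (h : IsSubextremal M a) {p : HPar} (hp : p ∈ hzU M a m) {t : ℝ} (ht : |t - rPlus M a| < 2 * hzC M a / 5)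
    {n : ℕ∞} : ContDiffAt ℝ n (fun q : HPar ↦ hzRhoC' M a m q.1 q.2.1 q.2.2 (t : ℂ)) p := by
  have hα := norm_hzParam_zero_lt m p.1 p.2.1 p.2.2 h hp
  have hζ : ‖((t : ℂ)) - rPlus M a‖ < 2 * hzC M a / 5 := by
    rw [show ((t : ℂ)) - rPlus M a = ((t - rPlus M a : ℝ) : ℂ) by push_cast; ring, Complex.norm_real, Real.norm_eq_abs]
    exact ht
  have hξ := norm_hzXi_lt h hζ
  have hF : ContDiffAt ℝ n (fun q : ℂ × HP ↦ heunDer q.2 q.1) (hzXi M a (t : ℂ), hzParam M a m p.1 p.2.1 p.2.2) :=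
    ((contDiffAt_heunDer hξ hα (n := ∞) le_rfl).restrict_scalars ℝ).of_le (by exact_mod_cast le_top)
  have hin : ContDiff ℝ n fun q : HPar ↦ ((hzXi M a (t : ℂ), hzParam M a m q.1 q.2.1 q.2.2) : ℂ × HP) :=
    contDiff_const.prodMk contDiff_hzParam_par
  unfold hzRhoC'
  exact (hF.comp p hin.contDiffAt).div_const _

/-- **Smoothness of the local solution in the parameters**: `p ↦ (Pρ)_p(t)` at `p ∈ hzU`,
`|t − r₊| < 2c/5`. [folklore] -/
theorem contDiffAt_hzRloc_par (h : IsSubextremal M a) {p : HPar} (hp : p ∈ hzU M a m) {t : ℝ} (ht : |t - rPlus M a| < 2 * hzC M a / 5)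
    {n : ℕ∞} : ContDiffAt ℝ n (fun q : HPar ↦ hzRloc M a m q.1 q.2.1 q.2.2 t) p := by
  unfold hzRloc
  exact (contDiff_hzPhase_par t).contDiffAt.mul (contDiffAt_hzRhoC_par h hp ht)

/-- Smoothness of `p ↦ (Pρ)'_p(t)` at `p ∈ hzU`, `|t − r₊| < 2c/5`. [folklore] -/
theorem contDiffAt_hzRloc'_par (h : IsSubextremal M a) {p : HPar} (hp : p ∈ hzU M a m) {t : ℝ} (ht : |t - rPlus M a| < 2 * hzC M a / 5)
    {n : ℕ∞} : ContDiffAt ℝ n (fun q : HPar ↦ hzRloc' M a m q.1 q.2.1 q.2.2 t) p := by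
  unfold hzRloc'
  exact (contDiff_hzPhase_par t).contDiffAt.mul ((contDiffAt_hzRhoC'_par h hp ht).sub
    (((contDiffAt_const.mul ((contDiff_hzK_par t).contDiffAt.div_const _)).mul (contDiffAt_hzRhoC_par h hp ht))))

/-! ### Smoothness of the values `p ↦ (R_p(t), R_p'(t))` -/

/-- The radial potential is jointly smooth in `((ω, Λ, μ), t)` (polynomial). [folklore] -/
theorem contDiff_kgRadialPotential_par {n : WithTop ℕ∞} :
    ContDiff ℝ n fun x : HPar × ℝ ↦ kgRadialPotential M a x.1.1 m x.1.2.1 x.1.2.2 x.2 := by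
  unfold kgRadialPotential delta; fun_prop

/-- The solved-form coefficient `q = V/Δ²` is jointly smooth on `HPar × (r₊, ∞)`. [folklore] -/
theorem contDiffOn_qc_par (h : IsSubextremal M a) {n : WithTop ℕ∞} :
    ContDiffOn ℝ n (fun x : HPar × ℝ ↦ kgRadialPotential M a x.1.1 m x.1.2.1 x.1.2.2 x.2 / (delta M a x.2 : ℂ) ^ 2)
      (univ ×ˢ Ioi (rPlus M a)) := by
  have hΔ : ∀ x ∈ (univ ×ˢ Ioi (rPlus M a) : Set (HPar × ℝ)), (delta M a x.2 : ℂ) ^ 2 ≠ 0 := fun _ hx ↦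
    pow_ne_zero 2 (by exact_mod_cast (delta_pos_of_gt h hx.2).ne')
  have h2 : ContDiff ℝ n (fun x : HPar × ℝ ↦ (delta M a x.2 : ℂ) ^ 2) := by unfold delta; fun_prop
  exact ((contDiff_kgRadialPotential_par (M := M) (a := a) (m := m)).contDiffOn.mul (h2.contDiffOn.inv hΔ)).congr fun x _ ↦ by
    simp only [Pi.inv_apply, div_eq_mul_inv]

/-- The solved-form coefficient `p = −Δ'/Δ` (parameter-independent) is jointly smooth on `HPar × (r₊, ∞)`. [folklore] -/
theorem contDiffOn_pc_par (h : IsSubextremal M a) {n : WithTop ℕ∞} :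
    ContDiffOn ℝ n (fun x : HPar × ℝ ↦ -((((2 * x.2 - 2 * M : ℝ)) : ℂ) / (delta M a x.2 : ℂ))) (univ ×ˢ Ioi (rPlus M a)) :=
  (contDiffOn_hzRadialP h (n := n)).comp contDiff_snd.contDiffOn fun _ hx ↦ hx.2

/-- The data map `p ↦ (R_p(r₁), R_p'(r₁))` is smooth on `hzU`. [folklore] -/
theorem contDiffOn_hPair_data (h : IsSubextremal M a) {n : ℕ∞} :
    ContDiffOn ℝ n (fun p : HPar ↦ (((hPair h m p).1 (kgR1 M a), (hPair h m p).2 (kgR1 M a)) : W2)) (hzU M a m) := by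
  intro p hp
  have hr₁ := kgR1_mem h
  have habs : |kgR1 M a - rPlus M a| < 2 * hzC M a / 5 := by
    have hc := hzC_pos h
    rw [abs_lt]; constructor <;> linarith [hr₁.1, hr₁.2]
  have h1 := contDiffAt_hzRloc_par (m := m) h hp habs (n := n)
  have h2 := contDiffAt_hzRloc'_par (m := m) h hp habs (n := n)
  refine ((h1.prodMk h2).contDiffWithinAt).congr (fun q _ ↦ ?_) ?_
  · exact Prod.ext (hPair_spec (m := m) h q).1 (hPair_spec (m := m) h q).2.1
  · exact Prod.ext (hPair_spec (m := m) h p).1 (hPair_spec (m := m) h p).2.1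

/-- **Smoothness of the values of the horizon-regular pair in the parameters**: for every
`t > r₊`, `p ↦ (R_p(t), R_p'(t))` is `C^∞` on `hzU` (on the disc: the explicit series; beyond:
transport with smooth parameter dependence). [cite: ShlapentokhRothman2014KleinGordon, App. A] -/
theorem contDiffOn_hPair_apply (h : IsSubextremal M a) {t : ℝ} (ht : rPlus M a < t) {n : ℕ∞} :
    ContDiffOn ℝ n (fun p : HPar ↦ (((hPair h m p).1 t, (hPair h m p).2 t) : W2)) (hzU M a m) := by
  have hc := hzC_pos h
  rcases lt_or_ge t (rPlus M a + 2 * hzC M a / 5) with hlow | hhigh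
  · have habs : |t - rPlus M a| < 2 * hzC M a / 5 := by rw [abs_lt]; constructor <;> linarith
    intro p hp
    have h1 := contDiffAt_hzRloc_par (m := m) h hp habs (n := n)
    have h2 := contDiffAt_hzRloc'_par (m := m) h hp habs (n := n)
    refine ((h1.prodMk h2).contDiffWithinAt).congr (fun q hq ↦ ?_) ?_
    · exact Prod.ext ((hPair_eqOn (m := m) h hq).1 ⟨ht, hlow⟩) ((hPair_eqOn (m := m) h hq).2 ⟨ht, hlow⟩)
    · exact Prod.ext ((hPair_eqOn (m := m) h hp).1 ⟨ht, hlow⟩) ((hPair_eqOn (m := m) h hp).2 ⟨ht, hlow⟩)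
  · have hr₁ := kgR1_mem h
    set r₁ := kgR1 M a with hr₁def
    have hn1 : (1 : ℕ∞) ≤ max n 1 := le_max_right _ _
    obtain ⟨Ψ, ε, hε, hΨ, htr⟩ := exists_transport_joint (P := HPar) (n := max n 1) hn1 (isOpen_hzU (M := M) (a := a) (m := m))
      hr₁.1 (show r₁ < t + 1 by linarith [hr₁.2])
      (pc := fun (_ : HPar) (s : ℝ) ↦ -((((2 * s - 2 * M : ℝ)) : ℂ) / (delta M a s : ℂ)))
      (qc := fun (q : HPar) (s : ℝ) ↦ kgRadialPotential M a q.1 m q.2.1 q.2.2 s / (delta M a s : ℂ) ^ 2)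
      ((contDiffOn_pc_par h).mono (prod_mono (subset_univ _) le_rfl)) ((contDiffOn_qc_par h).mono (prod_mono (subset_univ _) le_rfl))
    have htI : t ∈ Ioo (r₁ - ε) (t + 1 + ε) := by
      constructor
      · have : r₁ ≤ t := by rw [hr₁def]; unfold kgR1; linarith
        linarith
      · linarith
    -- the composite `p ↦ Ψ p t (data p)` is smooth on `hzU`
    have hdata := contDiffOn_hPair_data (m := m) h (n := max n 1)
    have hin : ContDiffOn ℝ (max n 1 : ℕ∞) (fun p : HPar ↦ ((p, (t, (((hPair h m p).1 r₁, (hPair h m p).2 r₁) : W2))) : HPar × ℝ × W2))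
        (hzU M a m) := contDiffOn_id.prodMk (contDiffOn_const.prodMk hdata)
    have hmaps : MapsTo (fun p : HPar ↦ ((p, (t, (((hPair h m p).1 r₁, (hPair h m p).2 r₁) : W2))) : HPar × ℝ × W2))
        (hzU M a m) (hzU M a m ×ˢ (Ioo (r₁ - ε) (t + 1 + ε) ×ˢ univ)) := fun p hp ↦ ⟨hp, htI, trivial⟩
    have hcomp := hΨ.comp hin hmaps
    refine (hcomp.of_le (by exact_mod_cast le_max_left n 1)).congr fun p hp ↦ ?_
    exact htr p hp _ _ (hPair_spec (m := m) h p).2.2 t htI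

/-! ### Joint smoothness in `(p, t)` -/

/-- The phase is jointly smooth in `(ω, t)` for `t > r₊`. [folklore] -/
theorem contDiffAt_hzPhase_joint2 (h : IsSubextremal M a) {x : HPar × ℝ} (hx : rPlus M a < x.2) {n : WithTop ℕ∞} :
    ContDiffAt ℝ n (fun y : HPar × ℝ ↦ hzPhase M a m y.1.1 y.2) x := by
  have hT : ContDiffAt ℝ n (fun y : HPar × ℝ ↦ ((starTime M a y.2 : ℝ) : ℂ)) x :=
    (contDiff_ofReal_par.contDiffAt).comp x (((contDiffOn_starTime h).contDiffAt (Ioi_mem_nhds hx)).comp x contDiffAt_snd)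
  have hA : ContDiffAt ℝ n (fun y : HPar × ℝ ↦ ((starAngle M a y.2 : ℝ) : ℂ)) x :=
    (contDiff_ofReal_par.contDiffAt).comp x (((contDiffOn_starAngle h).contDiffAt (Ioi_mem_nhds hx)).comp x contDiffAt_snd)
  have hw : ContDiffAt ℝ n (fun y : HPar × ℝ ↦ y.1.1) x := contDiffAt_fst.comp x contDiffAt_fst
  unfold hzPhase
  exact ((contDiffAt_const.mul ((hw.mul hT).sub (contDiffAt_const.mul hA))).neg).cexp

/-- The analytic factor is jointly smooth in `(p, t)` for `p ∈ hzU`, `|t − r₊| < 2c/5`. [folklore] -/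
theorem contDiffAt_hzRhoC_joint2 (h : IsSubextremal M a) {x : HPar × ℝ} (hp : x.1 ∈ hzU M a m) (ht : |x.2 - rPlus M a| < 2 * hzC M a / 5)
    {n : ℕ∞} : ContDiffAt ℝ n (fun y : HPar × ℝ ↦ hzRhoC M a m y.1.1 y.1.2.1 y.1.2.2 (y.2 : ℂ)) x := by
  have hα := norm_hzParam_zero_lt m x.1.1 x.1.2.1 x.1.2.2 h hp
  have hζ : ‖((x.2 : ℂ)) - rPlus M a‖ < 2 * hzC M a / 5 := by
    rw [show ((x.2 : ℂ)) - rPlus M a = ((x.2 - rPlus M a : ℝ) : ℂ) by push_cast; ring, Complex.norm_real, Real.norm_eq_abs]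
    exact ht
  have hξ := norm_hzXi_lt h hζ
  have hF : ContDiffAt ℝ n (fun q : ℂ × HP ↦ heunFun q.2 q.1) (hzXi M a (x.2 : ℂ), hzParam M a m x.1.1 x.1.2.1 x.1.2.2) :=
    ((contDiffAt_heunFun hξ hα (n := ∞) le_rfl).restrict_scalars ℝ).of_le (by exact_mod_cast le_top)
  have hin : ContDiff ℝ n fun y : HPar × ℝ ↦ ((hzXi M a (y.2 : ℂ), hzParam M a m y.1.1 y.1.2.1 y.1.2.2) : ℂ × HP) := by
    refine ContDiff.prodMk ?_ (contDiff_hzParam_par.comp contDiff_fst)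
    unfold hzXi; fun_prop
  exact hF.comp x hin.contDiffAt

/-- `ρ'` is jointly smooth in `(p, t)` for `p ∈ hzU`, `|t − r₊| < 2c/5`. [folklore] -/
theorem contDiffAt_hzRhoC'_joint2 (h : IsSubextremal M a) {x : HPar × ℝ} (hp : x.1 ∈ hzU M a m) (ht : |x.2 - rPlus M a| < 2 * hzC M a / 5)
    {n : ℕ∞} : ContDiffAt ℝ n (fun y : HPar × ℝ ↦ hzRhoC' M a m y.1.1 y.1.2.1 y.1.2.2 (y.2 : ℂ)) x := by
  have hα := norm_hzParam_zero_lt m x.1.1 x.1.2.1 x.1.2.2 h hp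
  have hζ : ‖((x.2 : ℂ)) - rPlus M a‖ < 2 * hzC M a / 5 := by
    rw [show ((x.2 : ℂ)) - rPlus M a = ((x.2 - rPlus M a : ℝ) : ℂ) by push_cast; ring, Complex.norm_real, Real.norm_eq_abs]
    exact ht
  have hξ := norm_hzXi_lt h hζ
  have hF : ContDiffAt ℝ n (fun q : ℂ × HP ↦ heunDer q.2 q.1) (hzXi M a (x.2 : ℂ), hzParam M a m x.1.1 x.1.2.1 x.1.2.2) :=
    ((contDiffAt_heunDer hξ hα (n := ∞) le_rfl).restrict_scalars ℝ).of_le (by exact_mod_cast le_top)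
  have hin : ContDiff ℝ n fun y : HPar × ℝ ↦ ((hzXi M a (y.2 : ℂ), hzParam M a m y.1.1 y.1.2.1 y.1.2.2) : ℂ × HP) := by
    refine ContDiff.prodMk ?_ (contDiff_hzParam_par.comp contDiff_fst)
    unfold hzXi; fun_prop
  unfold hzRhoC'
  exact (hF.comp x hin.contDiffAt).div_const _

/-- **`(p, t) ↦ (Pρ)_p(t)` is jointly smooth** for `p ∈ hzU`, `t ∈ (r₊, r₊ + 2c/5)`. [folklore] -/
theorem contDiffAt_hzRloc_joint2 (h : IsSubextremal M a) {x : HPar × ℝ} (hp : x.1 ∈ hzU M a m) (ht : x.2 ∈ Ioo (rPlus M a) (rPlus M a + 2 * hzC M a / 5))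
    {n : ℕ∞} : ContDiffAt ℝ n (fun y : HPar × ℝ ↦ hzRloc M a m y.1.1 y.1.2.1 y.1.2.2 y.2) x := by
  have hc := hzC_pos h
  have habs : |x.2 - rPlus M a| < 2 * hzC M a / 5 := by rw [abs_lt]; constructor <;> linarith [ht.1, ht.2]
  unfold hzRloc
  exact (contDiffAt_hzPhase_joint2 (m := m) h ht.1).mul (contDiffAt_hzRhoC_joint2 h hp habs)

/-- `(p, t) ↦ (Pρ)'_p(t)` is jointly smooth for `p ∈ hzU`, `t ∈ (r₊, r₊ + 2c/5)`. [folklore] -/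
theorem contDiffAt_hzRloc'_joint2 (h : IsSubextremal M a) {x : HPar × ℝ} (hp : x.1 ∈ hzU M a m) (ht : x.2 ∈ Ioo (rPlus M a) (rPlus M a + 2 * hzC M a / 5))
    {n : ℕ∞} : ContDiffAt ℝ n (fun y : HPar × ℝ ↦ hzRloc' M a m y.1.1 y.1.2.1 y.1.2.2 y.2) x := by
  have hc := hzC_pos h
  have habs : |x.2 - rPlus M a| < 2 * hzC M a / 5 := by rw [abs_lt]; constructor <;> linarith [ht.1, ht.2]
  have hK : ContDiffAt ℝ n (fun y : HPar × ℝ ↦ hzK a m y.1.1 y.2) x := by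
    have : ContDiff ℝ n (fun y : HPar × ℝ ↦ hzK a m y.1.1 y.2) := by unfold hzK; fun_prop
    exact this.contDiffAt
  have hΔ : ContDiffAt ℝ n (fun y : HPar × ℝ ↦ (delta M a y.2 : ℂ)) x := by
    have : ContDiff ℝ n (fun y : HPar × ℝ ↦ (delta M a y.2 : ℂ)) := by unfold delta; fun_prop
    exact this.contDiffAt
  have hΔ0 : (delta M a x.2 : ℂ) ≠ 0 := by exact_mod_cast (delta_pos_of_gt h ht.1).ne'
  have hKΔ : ContDiffAt ℝ n (fun y : HPar × ℝ ↦ hzK a m y.1.1 y.2 / (delta M a y.2 : ℂ)) x :=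
    (hK.mul (hΔ.inv hΔ0)).congr_of_eventuallyEq (Eventually.of_forall fun y ↦ div_eq_mul_inv _ _)
  unfold hzRloc'
  exact (contDiffAt_hzPhase_joint2 (m := m) h ht.1).mul ((contDiffAt_hzRhoC'_joint2 h hp habs).sub
    (((contDiffAt_const.mul hKΔ).mul (contDiffAt_hzRhoC_joint2 h hp habs))))

/-- **Joint smoothness of the horizon-regular pair in `(p, t)`** on `hzU × (r₊, ∞)`. [cite: ShlapentokhRothman2014KleinGordon, App. A] -/
theorem contDiffAt_hPair_joint (h : IsSubextremal M a) {x : HPar × ℝ} (hp : x.1 ∈ hzU M a m) (hx : rPlus M a < x.2) {n : ℕ∞} :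
    ContDiffAt ℝ n (fun y : HPar × ℝ ↦ (((hPair h m y.1).1 y.2, (hPair h m y.1).2 y.2) : W2)) x := by
  have hc := hzC_pos h
  rcases lt_or_ge x.2 (rPlus M a + 2 * hzC M a / 5) with hlow | hhigh
  · have hO : (hzU M a m ×ˢ Ioo (rPlus M a) (rPlus M a + 2 * hzC M a / 5) : Set (HPar × ℝ)) ∈ 𝓝 x :=
      (isOpen_hzU.prod isOpen_Ioo).mem_nhds ⟨hp, hx, hlow⟩
    have he : (fun y : HPar × ℝ ↦ (((hPair h m y.1).1 y.2, (hPair h m y.1).2 y.2) : W2)) =ᶠ[𝓝 x]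
        fun y ↦ ((hzRloc M a m y.1.1 y.1.2.1 y.1.2.2 y.2, hzRloc' M a m y.1.1 y.1.2.1 y.1.2.2 y.2) : W2) :=
      Filter.eventuallyEq_of_mem hO fun y hy ↦ Prod.ext ((hPair_eqOn (m := m) h hy.1).1 hy.2) ((hPair_eqOn (m := m) h hy.1).2 hy.2)
    exact ((contDiffAt_hzRloc_joint2 h hp ⟨hx, hlow⟩).prodMk (contDiffAt_hzRloc'_joint2 h hp ⟨hx, hlow⟩)).congr_of_eventuallyEq he
  · have hr₁ := kgR1_mem h
    set r₁ := kgR1 M a with hr₁def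
    have hn1 : (1 : ℕ∞) ≤ max n 1 := le_max_right _ _
    obtain ⟨Ψ, ε, hε, hΨ, htr⟩ := exists_transport_joint (P := HPar) (n := max n 1) hn1 (isOpen_hzU (M := M) (a := a) (m := m))
      hr₁.1 (show r₁ < x.2 + 1 by linarith [hr₁.2])
      (pc := fun (_ : HPar) (s : ℝ) ↦ -((((2 * s - 2 * M : ℝ)) : ℂ) / (delta M a s : ℂ)))
      (qc := fun (q : HPar) (s : ℝ) ↦ kgRadialPotential M a q.1 m q.2.1 q.2.2 s / (delta M a s : ℂ) ^ 2)
      ((contDiffOn_pc_par h).mono (prod_mono (subset_univ _) le_rfl)) ((contDiffOn_qc_par h).mono (prod_mono (subset_univ _) le_rfl))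
    have htI : x.2 ∈ Ioo (r₁ - ε) (x.2 + 1 + ε) := by
      constructor
      · have : r₁ ≤ x.2 := by rw [hr₁def]; unfold kgR1; linarith
        linarith
      · linarith
    have hO : (hzU M a m ×ˢ Ioo (r₁ - ε) (x.2 + 1 + ε) : Set (HPar × ℝ)) ∈ 𝓝 x := (isOpen_hzU.prod isOpen_Ioo).mem_nhds ⟨hp, htI⟩
    -- the composite `(p, t) ↦ Ψ p t (data p)` is jointly smooth near `x`
    have hdata := contDiffOn_hPair_data (m := m) h (n := max n 1)
    have hin : ContDiffOn ℝ (max n 1 : ℕ∞)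
        (fun y : HPar × ℝ ↦ ((y.1, (y.2, (((hPair h m y.1).1 r₁, (hPair h m y.1).2 r₁) : W2))) : HPar × ℝ × W2))
        (hzU M a m ×ˢ Ioo (r₁ - ε) (x.2 + 1 + ε)) :=
      contDiffOn_fst.prodMk (contDiffOn_snd.prodMk (hdata.comp contDiffOn_fst fun y hy ↦ hy.1))
    have hmaps : MapsTo (fun y : HPar × ℝ ↦ ((y.1, (y.2, (((hPair h m y.1).1 r₁, (hPair h m y.1).2 r₁) : W2))) : HPar × ℝ × W2))
        (hzU M a m ×ˢ Ioo (r₁ - ε) (x.2 + 1 + ε)) (hzU M a m ×ˢ (Ioo (r₁ - ε) (x.2 + 1 + ε) ×ˢ univ)) := fun y hy ↦ ⟨hy.1, hy.2, trivial⟩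
    have hcomp := (hΨ.comp hin hmaps).of_le (show ((n : ℕ∞) : WithTop ℕ∞) ≤ (max n 1 : ℕ∞) by exact_mod_cast le_max_left n 1)
    have hcA : ContDiffAt ℝ n (fun y : HPar × ℝ ↦ Ψ y.1 y.2 (((hPair h m y.1).1 r₁, (hPair h m y.1).2 r₁) : W2)) x := hcomp.contDiffAt hO
    refine hcA.congr_of_eventuallyEq (Filter.eventuallyEq_of_mem hO fun y hy ↦ ?_)
    exact htr y.1 hy.1 _ _ (hPair_spec (m := m) h y.1).2.2 y.2 hy.2

/-! ### The normal form family `yh p = √Δ R_p` -/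

/-- **The normal form of the horizon-regular solution**, `y_p = √Δ R_p`. [folklore] -/
def yh (h : IsSubextremal M a) (m : ℤ) (p : HPar) (t : ℝ) : ℂ := ((Real.sqrt (delta M a t) : ℝ) : ℂ) * (hPair h m p).1 t

/-- Its derivative `y_p' = Δ'/(2√Δ) R_p + √Δ R_p'`. [folklore] -/
def yh' (h : IsSubextremal M a) (m : ℤ) (p : HPar) (t : ℝ) : ℂ :=
  (((2 * t - 2 * M) / (2 * Real.sqrt (delta M a t)) : ℝ) : ℂ) * (hPair h m p).1 t + ((Real.sqrt (delta M a t) : ℝ) : ℂ) * (hPair h m p).2 t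

/-- **`y_p` solves `y'' = kgQc(·; ω, Λ, μ²) y` on `(r₊, ∞)`.** [cite: ShlapentokhRothman2014KleinGordon, §4.2] -/
theorem isSol2_yh (h : IsSubextremal M a) (p : HPar) :
    IsSol2 (kgQc M a m p.1 p.2.1 (((p.2.2 ^ 2 : ℝ)) : ℂ)) (yh h m p) (yh' h m p) (Ioi (rPlus M a)) :=
  isSol2_normalForm h (hPair_spec (m := m) h p).2.2

/-- **Smoothness of `p ↦ (y_p(t), y_p'(t))` on `hzU`** at every `t > r₊`. [folklore] -/
theorem contDiffOn_yh_apply (h : IsSubextremal M a) {t : ℝ} (ht : rPlus M a < t) {n : ℕ∞} :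
    ContDiffOn ℝ n (fun p : HPar ↦ yh h m p t) (hzU M a m) ∧ ContDiffOn ℝ n (fun p : HPar ↦ yh' h m p t) (hzU M a m) := by
  have hP := contDiffOn_hPair_apply (m := m) h ht (n := n)
  have h1 : ContDiffOn ℝ n (fun p : HPar ↦ (hPair h m p).1 t) (hzU M a m) := contDiff_fst.comp_contDiffOn hP
  have h2 : ContDiffOn ℝ n (fun p : HPar ↦ (hPair h m p).2 t) (hzU M a m) := contDiff_snd.comp_contDiffOn hP
  exact ⟨contDiffOn_const.mul h1, (contDiffOn_const.mul h1).add (contDiffOn_const.mul h2)⟩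

/-! ### Bridge from `IsRadialSolution` -/

/-- A radial solution in the sense of `IsRadialSolution` gives a solved-form pair `(R, deriv R)`. [folklore] -/
theorem IsRadialSolution.pair (h : IsSubextremal M a) {w Λ : ℂ} {μ : ℝ} {R : ℝ → ℂ} (hR : IsRadialSolution M a w m Λ μ R) :
    ∀ t ∈ Ioi (rPlus M a), HasDerivAt R (deriv R t) t ∧
      HasDerivAt (deriv R) (-((((2 * t - 2 * M : ℝ)) : ℂ) / (delta M a t : ℂ)) * deriv R t +
        kgRadialPotential M a w m Λ μ t / (delta M a t : ℂ) ^ 2 * R t) t := by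
  intro t ht
  have hΔ : (delta M a t : ℂ) ≠ 0 := by exact_mod_cast (delta_pos_of_gt h ht).ne'
  have hC : ContDiffAt ℝ ∞ R t := hR.1.contDiffAt (Ioi_mem_nhds ht)
  have hd1 : HasDerivAt R (deriv R t) t := (hC.differentiableAt (by simp)).hasDerivAt
  have hC2 : ContDiffAt ℝ 2 R t := hC.of_le (WithTop.coe_le_coe.2 le_top)
  have hd2 : HasDerivAt (deriv R) (deriv (deriv R) t) t :=
    ((hC2.derivWithin (m := 1) (by norm_num)).differentiableAt one_ne_zero).hasDerivAt
  refine ⟨hd1, hd2.congr_deriv ?_⟩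
  -- from `Δ (Δ R')' = V R` and `(Δ R')' = Δ' R' + Δ R''`
  have hprod : HasDerivAt (fun s ↦ (delta M a s : ℂ) * deriv R s) ((((2 * (t - M) : ℝ)) : ℂ) * deriv R t + (delta M a t : ℂ) * deriv (deriv R) t) t :=
    ((hasDerivAt_delta M a t).ofReal_comp).mul hd2
  have hode := hR.2 t ht
  rw [hprod.deriv] at hode
  field_simp
  push_cast at hode ⊢
  linear_combination hode

/-- **A radial solution agreeing with `hzRloc(p)` on the horizon disc is `R_p`**, with
`deriv R = R_p'`, on `(r₊, ∞)`. [folklore] -/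
theorem eqOn_hPair_of_isRadialSolution (h : IsSubextremal M a) {p : HPar} (hp : p ∈ hzU M a m) {R : ℝ → ℂ}
    (hR : IsRadialSolution M a p.1 m p.2.1 p.2.2 R) (hloc : EqOn R (hzRloc M a m p.1 p.2.1 p.2.2) (Ioo (rPlus M a) (rPlus M a + 2 * hzC M a / 5))) :
    EqOn R (hPair h m p).1 (Ioi (rPlus M a)) ∧ EqOn (deriv R) (hPair h m p).2 (Ioi (rPlus M a)) := by
  have hr₁ := kgR1_mem h
  obtain ⟨g0, g1, gsol⟩ := hPair_spec (m := m) h p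
  have hI : Ioo (rPlus M a) (rPlus M a + 2 * hzC M a / 5) ∈ 𝓝 (kgR1 M a) := Ioo_mem_nhds hr₁.1 hr₁.2
  have hd : deriv R (kgR1 M a) = hzRloc' M a m p.1 p.2.1 p.2.2 (kgR1 M a) := by
    have h1 : deriv R (kgR1 M a) = deriv (hzRloc M a m p.1 p.2.1 p.2.2) (kgR1 M a) :=
      Filter.EventuallyEq.deriv_eq (Filter.eventuallyEq_of_mem hI hloc)
    rw [h1, (hasDerivAt_hzRloc h hp hr₁.1 hr₁.2).deriv]
  exact eqOn_pair_Ioi (m := m) h hr₁.1 (IsRadialSolution.pair (m := m) h hR) gsol ((hloc hr₁).trans g0.symm) (hd.trans g1.symm)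

end Literature.Barriers.FinalStateConjecture

end
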